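import Summits.Ventures.YMGap.Thresholds.BallPieceTwoA
import Summits.Ventures.YMGap.Thresholds.BallPieceTwoB
import Summits.QuantumFields.BalabanUV.InfraRed.StrongCouplingTwelveSeventhsCertificate
import HarnessLib

/-!
# The ball-flux certificate beyond tilt `12/7`, part 2: the pieces `[12/7, 13/7]`, `[13/7, 2]` and the
certificate on `0 < κ ≤ 2` (pub-ymgap track (a), A4-K kernel port) — no mass-gap claim

HONEST FRAMING. Kernel port of engine-2's certified computation (cell pub-ymgap, `pub-ymgap-engine-2/A4K-CERT.md`)
that pub-balaban's order-2 ball-flux inequality — the tree's `ball_certificate` / `ball_certificate85` /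
`ball_certificate127` — continues to hold on the tilt range `12/7 < κ ≤ 2` (one-link laws with `‖B‖_op ≤ 1/2`, i.e.
Wilson `β_W ≤ 1/3` on the slab door).  Two pieces, each closed from the numerical Taylor brackets of part 1
(`N = 14`, tail constant `739/100 ≥ e²`) and the cancellation brackets by the SAME exact rational arithmetic as
`StrongCouplingTwelveSeventhsCertificate` (`hform_le` / `qform_ge` / `cert_core` / `cert_arith`), with the constants of
each piece.  Elementary real arithmetic; no statement about lattice measures, confinement or the mass gap; no number
of any ledger moves in this file.  Consumer: the one-link covariance bound for `‖B‖_op ≤ 1/2` and the quarter modulus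
up to Wilson `β_W ≤ 1/3` (next files), feeding the slab (Durhuus–Fröhlich) area-law door of the cell.

WHAT THIS FILE PROVES: `ball_certificate2 (hκ0 : 0 < κ) (hκ1 : κ ≤ 2) … : 16 m₂ (…) z_B ≤ (Z² − 16 z_B²)(z_B − (…))`
— the statement of `ball_certificate127` with `12/7 ↦ 2`; below `12/7` it IS `ball_certificate127`.
-/

noncomputable section

open MeasureTheory Filter Finset Real intervalIntegral
open scoped NNReal Quaternion Matrix BigOperators Topology Nat
open Matrix Complex
open Literature.MathematicalPhysics.QuantumLattice (su2Quat)
open Literature.MathematicalPhysics.QuantumFieldTheory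
open Summit.QuantumFields.BalabanUV.InfraRed.StrongCouplingTwelveSeventhsCertificate (ball_certificate127)
open Summit.Ventures.YMGap.BallBracketsTwo
open Summit.Ventures.YMGap.BallPieceTwoA (piece_brackets_p1 cancel_piece_p1 cert_arith_p1)
open Summit.Ventures.YMGap.BallPieceTwoB (piece_brackets_p2 cancel_piece_p2 cert_arith_p2)

namespace Summit.Ventures.YMGap.BallCertificateTwo

/-! ## The certificate on `0 < κ ≤ 2` -/

/-- **The ball-flux certificate on the range `0 < κ ≤ 2`** — the statement of the tree's `ball_certificate127` with
`12/7` replaced by `2`: `16 · m₂ · (c₀² z_B + 2c₀c₁ J41 + (c₁² + 2c₀c₂) J52 + 2c₁c₂ J63 + c₂² J74) · z_B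
≤ (Z² − 16 z_B²) · (z_B − (A² z_B + 2Aε J52 − 2Aτ J41 + ε² J72 − 2ετ J61 + τ² m₂))` (`τ = Z'/Z`, `A = 1 − κ²/20`,
`ε = κ²/20`, `c₀ = κA − 4τ`, `c₁ = κ²/4 − κτ`, `c₂ = κ³/20`).  Below `12/7`: `ball_certificate127`; on the two pieces:
part 1's brackets and `cert_arith_p1` ∕ `cert_arith_p2`. [folklore] -/
theorem ball_certificate2 {κ Z Zp zB m2 J41 J52 J61 J72 J63 J74 : ℝ} (hκ0 : 0 < κ) (hκ1 : κ ≤ 2)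
    (hZ : Z = ∫ g : Matrix.specialUnitaryGroup (Fin 2) ℂ, Real.exp (κ * (su2Quat g).re) ∂haarProbability (Matrix.specialUnitaryGroup (Fin 2) ℂ))
    (hZp : Zp = ∫ g : Matrix.specialUnitaryGroup (Fin 2) ℂ, (su2Quat g).re * Real.exp (κ * (su2Quat g).re)
        ∂haarProbability (Matrix.specialUnitaryGroup (Fin 2) ℂ))
    (hzB : zB = ∫ r in (0:ℝ)..1, r ^ 3 * ∫ g : Matrix.specialUnitaryGroup (Fin 2) ℂ,
        Real.exp (κ * r * (su2Quat g).re) ∂haarProbability (Matrix.specialUnitaryGroup (Fin 2) ℂ))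
    (hm2 : m2 = ∫ r in (0:ℝ)..1, r ^ 5 * ∫ g : Matrix.specialUnitaryGroup (Fin 2) ℂ,
        Real.exp (κ * r * (su2Quat g).re) ∂haarProbability (Matrix.specialUnitaryGroup (Fin 2) ℂ))
    (hJ41 : J41 = ∫ r in (0:ℝ)..1, r ^ 4 * ∫ g : Matrix.specialUnitaryGroup (Fin 2) ℂ,
        (su2Quat g).re * Real.exp (κ * r * (su2Quat g).re) ∂haarProbability (Matrix.specialUnitaryGroup (Fin 2) ℂ))
    (hJ52 : J52 = ∫ r in (0:ℝ)..1, r ^ 5 * ∫ g : Matrix.specialUnitaryGroup (Fin 2) ℂ,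
        (su2Quat g).re ^ 2 * Real.exp (κ * r * (su2Quat g).re) ∂haarProbability (Matrix.specialUnitaryGroup (Fin 2) ℂ))
    (hJ61 : J61 = ∫ r in (0:ℝ)..1, r ^ 6 * ∫ g : Matrix.specialUnitaryGroup (Fin 2) ℂ,
        (su2Quat g).re * Real.exp (κ * r * (su2Quat g).re) ∂haarProbability (Matrix.specialUnitaryGroup (Fin 2) ℂ))
    (hJ72 : J72 = ∫ r in (0:ℝ)..1, r ^ 7 * ∫ g : Matrix.specialUnitaryGroup (Fin 2) ℂ,
        (su2Quat g).re ^ 2 * Real.exp (κ * r * (su2Quat g).re) ∂haarProbability (Matrix.specialUnitaryGroup (Fin 2) ℂ))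
    (hJ63 : J63 = ∫ r in (0:ℝ)..1, r ^ 6 * ∫ g : Matrix.specialUnitaryGroup (Fin 2) ℂ,
        (su2Quat g).re ^ 3 * Real.exp (κ * r * (su2Quat g).re) ∂haarProbability (Matrix.specialUnitaryGroup (Fin 2) ℂ))
    (hJ74 : J74 = ∫ r in (0:ℝ)..1, r ^ 7 * ∫ g : Matrix.specialUnitaryGroup (Fin 2) ℂ,
        (su2Quat g).re ^ 4 * Real.exp (κ * r * (su2Quat g).re) ∂haarProbability (Matrix.specialUnitaryGroup (Fin 2) ℂ)) :
    16 * m2 * ((κ * (1 - κ ^ 2 / 20) - 4 * (Zp / Z)) ^ 2 * zB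
        + 2 * (κ * (1 - κ ^ 2 / 20) - 4 * (Zp / Z)) * (κ ^ 2 / 4 - κ * (Zp / Z)) * J41
        + ((κ ^ 2 / 4 - κ * (Zp / Z)) ^ 2 + 2 * (κ * (1 - κ ^ 2 / 20) - 4 * (Zp / Z)) * (κ ^ 3 / 20)) * J52
        + 2 * (κ ^ 2 / 4 - κ * (Zp / Z)) * (κ ^ 3 / 20) * J63 + (κ ^ 3 / 20) ^ 2 * J74) * zB
      ≤ (Z ^ 2 - 16 * zB ^ 2) * (zB - ((1 - κ ^ 2 / 20) ^ 2 * zB + 2 * (1 - κ ^ 2 / 20) * (κ ^ 2 / 20) * J52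
          - 2 * (1 - κ ^ 2 / 20) * (Zp / Z) * J41 + (κ ^ 2 / 20) ^ 2 * J72 - 2 * (κ ^ 2 / 20) * (Zp / Z) * J61
          + (Zp / Z) ^ 2 * m2)) := by
  rcases le_or_gt κ (12 / 7) with h127 | h127
  · exact ball_certificate127 hκ0 h127 hZ hZp hzB hm2 hJ41 hJ52 hJ61 hJ72 hJ63 hJ74
  have hκ : 0 ≤ κ := hκ0.le
  obtain ⟨hZl, hZu⟩ := Z_bracket2 hκ hκ1
  obtain ⟨hZpl, hZpu⟩ := Zp_bracket2 hκ hκ1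
  obtain ⟨hBl, hBu⟩ := zB_bracket2 hκ hκ1
  have hm2l : 0 ≤ ∫ r in (0:ℝ)..1, r ^ 5 * ∫ g : Matrix.specialUnitaryGroup (Fin 2) ℂ, Real.exp (κ * r * (su2Quat g).re) ∂(haarProbability (Matrix.specialUnitaryGroup (Fin 2) ℂ)) := by
    simpa using ball_nonneg2 0 5 hκ hκ1
  have hJ61l : 0 ≤ ∫ r in (0:ℝ)..1, r ^ 6 * ∫ g : Matrix.specialUnitaryGroup (Fin 2) ℂ, (su2Quat g).re * Real.exp (κ * r * (su2Quat g).re) ∂(haarProbability (Matrix.specialUnitaryGroup (Fin 2) ℂ)) := by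
    simpa using ball_nonneg2 1 6 hκ hκ1
  subst hZ hZp hzB hm2 hJ41 hJ52 hJ61 hJ72 hJ63 hJ74
  rcases le_or_gt κ (13 / 7) with h137 | h137
  · obtain ⟨b1, b2, b3, b4, b5, b6, b7, b8, b9, b10, b11, b12⟩ := piece_brackets_p1 h127.le h137
    obtain ⟨-, -, c1, c2, c3, c4, c5⟩ := cancel_piece_p1 h127.le h137 hZl hZu hZpl hZpu hBl hBu
    exact cert_arith_p1 h127.le h137 b1 b2 b3 b4 b5 b6 hm2l b7 b8 (ball_nonneg2 2 5 hκ hκ1) b9 hJ61l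
      (ball_nonneg2 2 7 hκ hκ1) b10 (ball_nonneg2 3 6 hκ hκ1) b11 (ball_nonneg2 4 7 hκ hκ1) b12 c1 c2 c3 c4 c5
  · obtain ⟨b1, b2, b3, b4, b5, b6, b7, b8, b9, b10, b11, b12⟩ := piece_brackets_p2 h137.le hκ1
    obtain ⟨-, -, c1, c2, c3, c4, c5⟩ := cancel_piece_p2 h137.le hκ1 hZl hZu hZpl hZpu hBl hBu
    exact cert_arith_p2 h137.le hκ1 b1 b2 b3 b4 b5 b6 hm2l b7 b8 (ball_nonneg2 2 5 hκ hκ1) b9 hJ61l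
      (ball_nonneg2 2 7 hκ hκ1) b10 (ball_nonneg2 3 6 hκ hκ1) b11 (ball_nonneg2 4 7 hκ hκ1) b12 c1 c2 c3 c4 c5

end Summit.Ventures.YMGap.BallCertificateTwo
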